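import Literature.AlgebraicGeometry.Motives.WeilConjecturesForProjectiveSpace
import Literature.NumberTheory.LFunctions.WeilFactorizationProducts
import HarnessLib

/-!
# The zeta function of a product of projective spaces: `#(ℙᵐ × ℙⁿ)(𝔽_{q^s}) = Σ_r c_r q^{rs}` with
# `c_r = #{(a, b) : a ≤ m, b ≤ n, a + b = r}`, `Z(ℙᵐ × ℙⁿ, T) = ∏_{a ≤ m, b ≤ n} (1 − q^{a+b}T)⁻¹`, and the Weil
# conjectures for `ℙᵐ × ℙⁿ`: `P_{2r} = (1 − qʳT)^{c_r}`, `P_odd = 1` (Künneth for the Betti numbers)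

Topic `Literature/AlgebraicGeometry/Motives`; THEOREMS ONLY (no definition, no instance, no named fact;
D-0026).  Sequel to `Motives/ZetaFunctionOfProjectiveSpace` / `Motives/WeilConjecturesForProjectiveSpace`
(`#ℙⁿ(𝔽_{q^s}) = Σ_{i ≤ n} q^{si}`, the Weil factorisation of `Z(ℙⁿ, T)`), with the tree's
`pointCount_tensorObj` (`#(X ×ₖ Y)(𝔽_{q^s}) = #X · #Y`), `LFunctions/WeilFactorizationProducts`
(`exists_isWeilFactorization_tensor`: Weil factorisations are closed under products; `IsWeilFactorization.unique`)
and `Motives/PolynomialPointCountsBettiNumbers` (`IsWeilFactorization.pointCount_eq_sum_iff_eq_pow`: a polynomial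
point count `Σ_r b_r q^{rs}` pins the factorisation to `P_{2r} = (1 − qʳT)^{b_r}`, `P_odd = 1`).

## Sources, read on the page

N. Ramachandran, *Zeta functions, Grothendieck groups, and the Witt ring* [Ramachandran2014], Theorem 2.1 (i)
«`Z(X × Y, t) = Z(X, t) ∗ Z(Y, t)` (Witt product)», first proof «`#(X × Y)(𝔽_{qⁿ}) = #X(𝔽_{qⁿ}) · #Y(𝔽_{qⁿ})`»,
§1 «`[a] ∗ [b] = [ab]`, `[a] = (1 − at)⁻¹`», Remark 2.2 (iii) «`Z(ℙⁿ, t) = [qⁿ] +_W ⋯ +_W [1]`» (arXiv p. 6) —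
hence `Z(ℙᵐ × ℙⁿ) = Σ_{W, a ≤ m, b ≤ n} [q^{a+b}] = ∏_{a,b} (1 − q^{a+b}t)⁻¹`.
L. Göttsche, *Hilbert schemes of zero-dimensional subschemes* [Gottsche1993], §1.2 Remark 1.2.2 (p. 7): a polynomial
count `|X(𝔽_{qⁿ})| = F(qⁿ)` gives `p(X̄, −z) = F(z²)`, i.e. `b_{2r} = [tʳ]F`, `b_{2r+1} = 0` — here
`F = (1 + t + ⋯ + tᵐ)(1 + t + ⋯ + tⁿ)`, `[tʳ]F = c_r`.
R. Hartshorne, *Algebraic Geometry* [Hartshorne1977], App. C Ex. 5.2 (`Z(𝐏ⁿ, t)`, «Verify the Weil conjectures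
for `Pⁿ`») and (1.4) («`E = Σ (−1)ⁱ Bᵢ`»).

## What is here (`k` finite, `q = #k`; `c_r := #{(a, b) ∈ [0, m] × [0, n] | a + b = r}` written as the
cardinality of a filtered `Finset.range (m+1) ×ˢ Finset.range (n+1)`)

* §1 `sum_sum_range_eq_sum_card_filter_smul` (`Σ_{a ≤ m} Σ_{b ≤ n} g(a + b) = Σ_{r ≤ m+n} c_r · g(r)`),
  `sum_card_filter_add_eq` (`Σ_r c_r = (m + 1)(n + 1)`), `card_filter_add_eq_top` (`c_{m+n} = 1`),
  `card_filter_add_eq_zero'` (`c_0 = 1`).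
* §2 **`pointCount_projectiveSpace_tensor`** (`#(ℙᵐ × ℙⁿ)(𝔽_{q^s}) = (Σ_{a ≤ m} q^{sa})(Σ_{b ≤ n} q^{sb})`,
  Ramachandran's first proof), **`pointCount_projectiveSpace_tensor_eq_sum`** (`= Σ_{r ≤ m+n} c_r q^{sr}`),
  **`zetaSeries_projectiveSpace_tensor_mul_prod`** (`Z(ℙᵐ × ℙⁿ, T) · ∏_{a ≤ m, b ≤ n} (1 − q^{a+b}T) = 1`: the
  Witt product `[qᵃ] ∗ [qᵇ] = [q^{a+b}]`).
* §3 the Weil conjectures for `ℙᵐ × ℙⁿ`: `exists_isWeilFactorization_projectiveSpace_tensor` (dimension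
  `m + n`, from `exists_isWeilFactorization_tensor`), **`IsWeilFactorization.eq_of_projectiveSpace_tensor`**
  (ANY Weil factorisation in dimension `m + n` has `P_{2r+1} = 1` and `P_{2r} = (1 − qʳT)^{c_r}`),
  **`IsWeilFactorization.natDegree_eq_of_projectiveSpace_tensor`** (Künneth: `b_{2r}(ℙᵐ × ℙⁿ) = c_r =
  Σ_{a+b=r} b_{2a}(ℙᵐ) b_{2b}(ℙⁿ)`, `b_odd = 0`), `IsWeilFactorization.eulerChar_eq_of_projectiveSpace_tensor`
  (`Σ (−1)ⁱ deg Pᵢ = (m+1)(n+1)`), `IsWeilFactorization.eq_dim_of_projectiveSpace_tensor` (the dimension is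
  forced to be `m + n`), `existsUnique_isWeilFactorization_projectiveSpace_tensor`.

HC is not touched.

## References

* [Ramachandran2014] N. Ramachandran, *Zeta functions, Grothendieck groups, and the Witt ring*, Bull. Sci. Math.
  139 (2015), Thm. 2.1 (i), §1, Rem. 2.2 (iii).
* [Gottsche1993] L. Göttsche, *Hilbert schemes of zero-dimensional subschemes of smooth varieties*, LNM 1572
  (1994), §1.2 Remark 1.2.2.
* [Hartshorne1977] R. Hartshorne, *Algebraic Geometry*, GTM 52 (1977), App. C §1 (1.4), Ex. 5.2.

## Provenance

Lane `lit-hodgefound` (summit `HodgeConjecture`, Track 2 foundations library, Layer B: motives / zeta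
functions), seat `lit-hodgefound-p29` (literature-prover, generation 48, row g48-#6).
-/

universe u

open Polynomial CategoryTheory MonoidalCategory
open Literature.NumberTheory.LFunctions (exists_isWeilFactorization_tensor)
open Literature.NumberTheory.LFunctions.Dwork (countZeta countZeta_congr countZeta_pow_mul countZeta_sum
  zetaSeries_eq_countZeta)

noncomputable section

namespace Literature.AlgebraicGeometry.Motives

/-! ### §1 The numbers `c_r = #{(a, b) : a ≤ m, b ≤ n, a + b = r}` -/

section Counting

/-- **Regrouping a double sum by `a + b`**: `Σ_{a ≤ m} Σ_{b ≤ n} g(a + b) = Σ_{r ≤ m+n} c_r · g(r)` with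
`c_r = #{(a, b) : a ≤ m, b ≤ n, a + b = r}` (the coefficient `[tʳ]` of `(1 + ⋯ + tᵐ)(1 + ⋯ + tⁿ)`).
[cite: Gottsche1993, §1.2 Remark 1.2.2 (proof) p. 7] -/
theorem sum_sum_range_eq_sum_card_filter_smul {M : Type*} [AddCommMonoid M] (m n : ℕ) (g : ℕ → M) :
    ∑ a ∈ Finset.range (m + 1), ∑ b ∈ Finset.range (n + 1), g (a + b) =
      ∑ r ∈ Finset.range (m + n + 1),
        ((Finset.range (m + 1) ×ˢ Finset.range (n + 1)).filter (fun ab : ℕ × ℕ => ab.1 + ab.2 = r)).card •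
          g r := by
  rw [← Finset.sum_product' (Finset.range (m + 1)) (Finset.range (n + 1)) (fun a b => g (a + b)),
    ← Finset.sum_fiberwise_of_maps_to' (t := Finset.range (m + n + 1)) (g := fun ab : ℕ × ℕ => ab.1 + ab.2)
      (fun ab hab => by
        rw [Finset.mem_product, Finset.mem_range, Finset.mem_range] at hab
        rw [Finset.mem_range]
        omega)]
  exact Finset.sum_congr rfl fun r _ => by rw [Finset.sum_const]

/-- `Σ_{r ≤ m+n} c_r = (m + 1)(n + 1)` (every pair `(a, b)` has exactly one sum). [cite: Gottsche1993, §1.2 Remark 1.2.2 (proof) p. 7] -/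
theorem sum_card_filter_add_eq (m n : ℕ) :
    ∑ r ∈ Finset.range (m + n + 1),
        ((Finset.range (m + 1) ×ˢ Finset.range (n + 1)).filter (fun ab : ℕ × ℕ => ab.1 + ab.2 = r)).card =
      (m + 1) * (n + 1) := by
  have h := sum_sum_range_eq_sum_card_filter_smul m n (fun _ => (1 : ℕ))
  simp only [Finset.sum_const, Finset.card_range, smul_eq_mul, mul_one] at h
  exact h.symm

/-- `c_{m+n} = 1`: only `(m, n)` has sum `m + n`. [cite: Gottsche1993, §1.2 Remark 1.2.2 (proof) p. 7] -/
theorem card_filter_add_eq_top (m n : ℕ) :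
    ((Finset.range (m + 1) ×ˢ Finset.range (n + 1)).filter (fun ab : ℕ × ℕ => ab.1 + ab.2 = m + n)).card = 1 := by
  rw [Finset.card_eq_one]
  refine ⟨(m, n), ?_⟩
  ext ⟨a, b⟩
  simp only [Finset.mem_filter, Finset.mem_product, Finset.mem_range, Finset.mem_singleton, Prod.mk.injEq]
  omega

/-- `c_0 = 1`: only `(0, 0)` has sum `0`. [cite: Gottsche1993, §1.2 Remark 1.2.2 (proof) p. 7] -/
theorem card_filter_add_eq_zero' (m n : ℕ) :
    ((Finset.range (m + 1) ×ˢ Finset.range (n + 1)).filter (fun ab : ℕ × ℕ => ab.1 + ab.2 = 0)).card = 1 := by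
  rw [Finset.card_eq_one]
  refine ⟨(0, 0), ?_⟩
  ext ⟨a, b⟩
  simp only [Finset.mem_filter, Finset.mem_product, Finset.mem_range, Finset.mem_singleton, Prod.mk.injEq]
  omega

end Counting

/-! ### §2 Point counts and the zeta function of `ℙᵐ × ℙⁿ` -/

section PointCount

variable {k : Type u} [Field k] [Finite k] {m n : ℕ}

/-- **`#(ℙᵐ × ℙⁿ)(𝔽_{q^s}) = #ℙᵐ(𝔽_{q^s}) · #ℙⁿ(𝔽_{q^s}) = (Σ_{a ≤ m} q^{sa})(Σ_{b ≤ n} q^{sb})`** for `s ≥ 1`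
(Ramachandran, first proof of Thm. 2.1 (i): «`#(X × Y)(𝔽_{qⁿ}) = #X(𝔽_{qⁿ}) · #Y(𝔽_{qⁿ})`»; the tree's
`pointCount_tensorObj` and `pointCount_projectiveSpace`). [cite: Ramachandran2014, Theorem 2.1 (i) (first proof)] -/
theorem pointCount_projectiveSpace_tensor {s : ℕ} (hs : 0 < s) :
    pointCount (projectiveSpace m k ⊗ projectiveSpace n k) s =
      (∑ a ∈ Finset.range (m + 1), Nat.card k ^ (s * a)) * ∑ b ∈ Finset.range (n + 1), Nat.card k ^ (s * b) := by
  rw [pointCount_tensorObj, pointCount_projectiveSpace hs, pointCount_projectiveSpace hs]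

/-- **`#(ℙᵐ × ℙⁿ)(𝔽_{q^s}) = Σ_{r ≤ m+n} c_r q^{rs}`**, `c_r = #{(a, b) : a ≤ m, b ≤ n, a + b = r}` — a polynomial
point count with counting polynomial `(1 + t + ⋯ + tᵐ)(1 + t + ⋯ + tⁿ)` (Göttsche's `F`).
[cite: Ramachandran2014, Theorem 2.1 (i) (first proof)] [cite: Gottsche1993, §1.2 Remark 1.2.2 p. 7] -/
theorem pointCount_projectiveSpace_tensor_eq_sum {s : ℕ} (hs : 0 < s) :
    pointCount (projectiveSpace m k ⊗ projectiveSpace n k) s =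
      ∑ r ∈ Finset.range (m + n + 1),
        ((Finset.range (m + 1) ×ˢ Finset.range (n + 1)).filter (fun ab : ℕ × ℕ => ab.1 + ab.2 = r)).card *
          Nat.card k ^ (r * s) := by
  have h := sum_sum_range_eq_sum_card_filter_smul m n (fun r => Nat.card k ^ (r * s))
  simp only [smul_eq_mul] at h
  rw [pointCount_projectiveSpace_tensor hs, Finset.sum_mul_sum, ← h]
  refine Finset.sum_congr rfl fun a _ => Finset.sum_congr rfl fun b _ => ?_
  rw [← pow_add, ← mul_add, mul_comm]

/-- The polynomial point count of `ℙᵐ × ℙⁿ` in the rational form consumed by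
`Motives/PolynomialPointCountsBettiNumbers`. [cite: Gottsche1993, §1.2 Remark 1.2.2 p. 7] -/
theorem pointCount_projectiveSpace_tensor_eq_sum_cast {s : ℕ} (hs : 0 < s) :
    (pointCount (projectiveSpace m k ⊗ projectiveSpace n k) s : ℚ) =
      ∑ r ∈ Finset.range (m + n + 1),
        ((fun r => ((Finset.range (m + 1) ×ˢ Finset.range (n + 1)).filter
            (fun ab : ℕ × ℕ => ab.1 + ab.2 = r)).card : ℕ → ℕ) r : ℚ) * (Nat.card k : ℚ) ^ (r * s) := by
  rw [pointCount_projectiveSpace_tensor_eq_sum hs, Nat.cast_sum]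
  exact Finset.sum_congr rfl fun r _ => by rw [Nat.cast_mul, Nat.cast_pow]

/-- **`Z(ℙᵐ × ℙⁿ, T) · ∏_{a ≤ m, b ≤ n} (1 − q^{a+b}T) = 1`**: `Z(ℙᵐ × ℙⁿ) = Σ_W [qᵃ] ∗ [qᵇ] = Σ_W [q^{a+b}]`
(Ramachandran Thm. 2.1 (i) `Z(X × Y) = Z(X) ∗ Z(Y)` with Rem. 2.2 (iii) and «`[a] ∗ [b] = [ab]`», `[c] = (1 − ct)⁻¹`;
the tree's `Dwork.countZeta_sum`, `countZeta_pow_mul`). [cite: Ramachandran2014, Theorem 2.1 (i) and Remark 2.2 (iii)] -/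
theorem zetaSeries_projectiveSpace_tensor_mul_prod :
    zetaSeries (projectiveSpace m k ⊗ projectiveSpace n k) *
      ∏ ab ∈ Finset.range (m + 1) ×ˢ Finset.range (n + 1),
        ((1 - Polynomial.C ((Nat.card k : ℚ) ^ (ab.1 + ab.2)) * Polynomial.X : ℚ[X]) : PowerSeries ℚ) = 1 := by
  have hZ : zetaSeries (projectiveSpace m k ⊗ projectiveSpace n k) =
      ∏ ab ∈ Finset.range (m + 1) ×ˢ Finset.range (n + 1),
        countZeta (fun s => ((Nat.card k : ℤ) ^ (ab.1 + ab.2)) ^ s) := by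
    rw [zetaSeries_eq_countZeta, ← countZeta_sum]
    refine countZeta_congr fun s hs => ?_
    rw [Finset.sum_apply, Finset.sum_product, pointCount_projectiveSpace_tensor hs, Nat.cast_mul,
      Nat.cast_sum, Nat.cast_sum, Finset.sum_mul_sum]
    refine Finset.sum_congr rfl fun a _ => Finset.sum_congr rfl fun b _ => ?_
    push_cast
    ring
  rw [hZ, ← Finset.prod_mul_distrib]
  refine Finset.prod_eq_one fun ab _ => ?_
  have h := countZeta_pow_mul ((Nat.card k : ℤ) ^ (ab.1 + ab.2))
  rw [Int.cast_pow, Int.cast_natCast] at h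
  exact h

/-- **`ℙ¹ × ℙ¹`: `#(ℙ¹ × ℙ¹)(𝔽_{q^s}) = (qˢ + 1)²`** (e.g. `q² + 2q + 1` rational points).
[cite: Ramachandran2014, Theorem 2.1 (i) (first proof)] -/
theorem pointCount_projectiveLine_tensor_projectiveLine {s : ℕ} (hs : 0 < s) :
    pointCount (projectiveSpace 1 k ⊗ projectiveSpace 1 k) s = (Nat.card k ^ s + 1) ^ 2 := by
  rw [pointCount_tensorObj, pointCount_projectiveLine hs, sq]

end PointCount

/-! ### §3 The Weil conjectures for `ℙᵐ × ℙⁿ` -/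

section Weil

variable {k : Type u} [Field k] [Finite k] {m n : ℕ}

/-- `Z(ℙᵐ × ℙⁿ, T)` admits a Weil factorisation in dimension `m + n` (the tree's closure of Weil factorisations
under products, `exists_isWeilFactorization_tensor`, applied to `isWeilFactorization_projectiveSpace`).
[cite: Ramachandran2014, Theorem 2.1 (i)] [cite: Hartshorne1977, App. C Ex. 5.2] -/
theorem exists_isWeilFactorization_projectiveSpace_tensor :
    ∃ P : Fin (2 * (m + n) + 1) → ℤ[X],
      IsWeilFactorization (Nat.card k) (m + n) (zetaSeries (projectiveSpace m k ⊗ projectiveSpace n k)) P :=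
  exists_isWeilFactorization_tensor ⟨_, isWeilFactorization_projectiveSpace⟩
    ⟨_, isWeilFactorization_projectiveSpace⟩

/-- **The Weil factorisation of `Z(ℙᵐ × ℙⁿ, T)`**: any Weil factorisation `(Pᵢ)_{i ≤ 2(m+n)}` in dimension
`m + n` has `Pᵢ = 1` for `i` odd and `P_{2r} = (1 − qʳT)^{c_r}`, `c_r = #{(a, b) : a ≤ m, b ≤ n, a + b = r}`
(Göttsche's «read off the set of pairs» on the count `Σ c_r q^{rs}`; tree
`IsWeilFactorization.pointCount_eq_sum_iff_eq_pow`). [cite: Gottsche1993, §1.2 Remark 1.2.2 (proof) p. 7] [cite: Ramachandran2014, Theorem 2.1 (i)] -/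
theorem IsWeilFactorization.eq_of_projectiveSpace_tensor {P : Fin (2 * (m + n) + 1) → ℤ[X]}
    (hW : IsWeilFactorization (Nat.card k) (m + n) (zetaSeries (projectiveSpace m k ⊗ projectiveSpace n k)) P) :
    (∀ i : Fin (2 * (m + n) + 1), Odd (i : ℕ) → P i = 1) ∧
      ∀ (i : Fin (2 * (m + n) + 1)) (r : ℕ), (i : ℕ) = 2 * r →
        P i = (1 - C ((Nat.card k : ℤ) ^ r) * X) ^
          ((Finset.range (m + 1) ×ˢ Finset.range (n + 1)).filter (fun ab : ℕ × ℕ => ab.1 + ab.2 = r)).card :=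
  (hW.pointCount_eq_sum_iff_eq_pow _).mp fun _ hs => pointCount_projectiveSpace_tensor_eq_sum_cast hs

/-- `deg (1 − aT) = 1` for `a ≠ 0` (private helper). [folklore] -/
private theorem natDegree_one_sub_C_mul_X {a : ℤ} (ha : a ≠ 0) : (1 - C a * X : ℤ[X]).natDegree = 1 := by
  rw [sub_eq_add_neg, ← neg_mul, ← C_neg, add_comm, ← C_1]
  exact natDegree_linear (neg_ne_zero.mpr ha)

/-- **Künneth for the Betti numbers of `ℙᵐ × ℙⁿ`**: `deg P_{2r} = c_r = Σ_{a+b=r} b_{2a}(ℙᵐ)·b_{2b}(ℙⁿ)` and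
`deg P_{2r+1} = 0` for any Weil factorisation of `Z(ℙᵐ × ℙⁿ, T)` in dimension `m + n` (Göttsche: `b_{2r} = [tʳ]F`
for the counting polynomial `F = (Σ_{a ≤ m} tᵃ)(Σ_{b ≤ n} tᵇ)`). [cite: Gottsche1993, §1.2 Remark 1.2.2 pp. 6–7] [cite: Hartshorne1977, App. C §1 (1.4)] -/
theorem IsWeilFactorization.natDegree_eq_of_projectiveSpace_tensor {P : Fin (2 * (m + n) + 1) → ℤ[X]}
    (hW : IsWeilFactorization (Nat.card k) (m + n) (zetaSeries (projectiveSpace m k ⊗ projectiveSpace n k)) P)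
    (i : Fin (2 * (m + n) + 1)) :
    (P i).natDegree = if Even (i : ℕ) then
      ((Finset.range (m + 1) ×ˢ Finset.range (n + 1)).filter (fun ab : ℕ × ℕ => ab.1 + ab.2 = (i : ℕ) / 2)).card
      else 0 := by
  obtain ⟨hodd, heven⟩ := hW.eq_of_projectiveSpace_tensor
  by_cases hi : Even (i : ℕ)
  · obtain ⟨r, hr⟩ := hi
    have hq : (Nat.card k : ℤ) ^ r ≠ 0 := pow_ne_zero r (by exact_mod_cast Nat.card_pos.ne')
    rw [if_pos ⟨r, hr⟩, heven i r (by omega), show (i : ℕ) / 2 = r by omega, natDegree_pow,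
      natDegree_one_sub_C_mul_X hq, mul_one]
  · rw [if_neg hi, hodd i (Nat.not_even_iff_odd.mp hi), natDegree_one]

/-- Re-indexing the even degrees `0, 2, …, 2N` by `r ↦ 2r` for sums (private helper). [folklore] -/
private theorem sum_range_ite_even_eq {M : Type*} [AddCommMonoid M] (N : ℕ) (g : ℕ → M) :
    ∑ i ∈ Finset.range (2 * N + 1), (if Even i then g (i / 2) else 0) = ∑ r ∈ Finset.range (N + 1), g r := by
  rw [← Finset.sum_filter]
  have himg : (Finset.range (2 * N + 1)).filter Even = (Finset.range (N + 1)).image (fun r => 2 * r) := by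
    ext i
    simp only [Finset.mem_filter, Finset.mem_range, Finset.mem_image]
    constructor
    · rintro ⟨hi, r, hr⟩
      exact ⟨r, by omega, by omega⟩
    · rintro ⟨r, hr, rfl⟩
      exact ⟨by omega, even_two_mul r⟩
  rw [himg, Finset.sum_image fun a _ b _ h => by omega]
  exact Finset.sum_congr rfl fun r _ => by rw [Nat.mul_div_cancel_left r two_pos]

/-- **The Euler characteristic of `ℙᵐ × ℙⁿ` is `(m + 1)(n + 1)`**: `Σ_{i=0}^{2(m+n)} (−1)ⁱ deg Pᵢ = Σ_r c_r =
(m + 1)(n + 1)` for any Weil factorisation of `Z(ℙᵐ × ℙⁿ, T)` (Hartshorne (1.4) «`E = Σ (−1)ⁱ Bᵢ`»;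
multiplicativity of the Euler characteristic). [cite: Hartshorne1977, App. C §1 (1.4)] [cite: Gottsche1993, §1.2 Remark 1.2.2 pp. 6–7] -/
theorem IsWeilFactorization.eulerChar_eq_of_projectiveSpace_tensor {P : Fin (2 * (m + n) + 1) → ℤ[X]}
    (hW : IsWeilFactorization (Nat.card k) (m + n) (zetaSeries (projectiveSpace m k ⊗ projectiveSpace n k)) P) :
    (∑ i : Fin (2 * (m + n) + 1), (-1 : ℤ) ^ (i : ℕ) * ((P i).natDegree : ℤ)) = (m + 1) * (n + 1) := by
  have h1 : ∀ i : Fin (2 * (m + n) + 1), (-1 : ℤ) ^ (i : ℕ) * ((P i).natDegree : ℤ) =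
      if Even (i : ℕ) then ((((Finset.range (m + 1) ×ˢ Finset.range (n + 1)).filter
        (fun ab : ℕ × ℕ => ab.1 + ab.2 = (i : ℕ) / 2)).card : ℕ) : ℤ) else 0 := fun i => by
    rw [hW.natDegree_eq_of_projectiveSpace_tensor i]
    split_ifs with hi
    · rw [hi.neg_one_pow, one_mul]
    · rw [Nat.cast_zero, mul_zero]
  rw [Finset.sum_congr rfl fun i _ => h1 i,
    Fin.sum_univ_eq_sum_range (fun i => if Even i then ((((Finset.range (m + 1) ×ˢ Finset.range (n + 1)).filter
      (fun ab : ℕ × ℕ => ab.1 + ab.2 = i / 2)).card : ℕ) : ℤ) else 0) (2 * (m + n) + 1),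
    sum_range_ite_even_eq (m + n) (fun t => ((((Finset.range (m + 1) ×ˢ Finset.range (n + 1)).filter
      (fun ab : ℕ × ℕ => ab.1 + ab.2 = t)).card : ℕ) : ℤ)), ← Nat.cast_sum, sum_card_filter_add_eq]
  push_cast
  ring

/-- **The dimension is forced**: a Weil factorisation of `Z(ℙᵐ × ℙⁿ, T)` in dimension `d` has `d = m + n`
(`c_{m+n} = 1 ≠ 0`; tree `le_and_eq_one_of_pointCount_eq_sum` / `eq_zero_of_lt_of_pointCount_eq_sum`).
[cite: Gottsche1993, §1.2 Remark 1.2.2 pp. 6–7] -/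
theorem IsWeilFactorization.eq_dim_of_projectiveSpace_tensor {d : ℕ} {P : Fin (2 * d + 1) → ℤ[X]}
    (hW : IsWeilFactorization (Nat.card k) d (zetaSeries (projectiveSpace m k ⊗ projectiveSpace n k)) P) :
    d = m + n := by
  have hc : ∀ s : ℕ, 0 < s → (pointCount (projectiveSpace m k ⊗ projectiveSpace n k) s : ℚ) =
      ∑ r ∈ Finset.range (m + n + 1), (fun r => ((((Finset.range (m + 1) ×ˢ Finset.range (n + 1)).filter
        (fun ab : ℕ × ℕ => ab.1 + ab.2 = r)).card : ℕ) : ℚ)) r * (Nat.card k : ℚ) ^ (r * s) := fun _ hs =>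
    pointCount_projectiveSpace_tensor_eq_sum_cast hs
  obtain ⟨hdn, -, -⟩ := hW.le_and_eq_one_of_pointCount_eq_sum hc
  by_contra hne
  have h := hW.eq_zero_of_lt_of_pointCount_eq_sum hc le_rfl (lt_of_le_of_ne hdn hne)
  rw [card_filter_add_eq_top, Nat.cast_one] at h
  exact one_ne_zero h

/-- `Z(ℙᵐ × ℙⁿ, T)` admits a Weil factorisation in dimension `d` iff `d = m + n`.
[cite: Ramachandran2014, Theorem 2.1 (i)] [cite: Gottsche1993, §1.2 Remark 1.2.2 pp. 6–7] -/
theorem exists_isWeilFactorization_projectiveSpace_tensor_iff {d : ℕ} :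
    (∃ P : Fin (2 * d + 1) → ℤ[X],
        IsWeilFactorization (Nat.card k) d (zetaSeries (projectiveSpace m k ⊗ projectiveSpace n k)) P) ↔
      d = m + n := by
  constructor
  · rintro ⟨P, hW⟩
    exact hW.eq_dim_of_projectiveSpace_tensor
  · rintro rfl
    exact exists_isWeilFactorization_projectiveSpace_tensor

/-- The Weil factorisation of `Z(ℙᵐ × ℙⁿ, T)` in dimension `m + n` is unique (tree `IsWeilFactorization.unique`).
[cite: Ramachandran2014, Theorem 2.1 (i) (second proof)] -/
theorem existsUnique_isWeilFactorization_projectiveSpace_tensor :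
    ∃! P : Fin (2 * (m + n) + 1) → ℤ[X],
      IsWeilFactorization (Nat.card k) (m + n) (zetaSeries (projectiveSpace m k ⊗ projectiveSpace n k)) P := by
  obtain ⟨P, hP⟩ := exists_isWeilFactorization_projectiveSpace_tensor (k := k) (m := m) (n := n)
  exact ⟨P, hP, fun P' hP' => IsWeilFactorization.unique Finite.one_lt_card hP' hP⟩

/-- **`ℙ¹ × ℙ¹`**: any Weil factorisation of `Z(ℙ¹ × ℙ¹, T)` in dimension `2` has `P₂ = (1 − qT)²` (`b₂ = 2`:
the two rulings), `P₁ = P₃ = 1`. [cite: Gottsche1993, §1.2 Remark 1.2.2 p. 7] -/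
theorem IsWeilFactorization.eq_of_projectiveLine_tensor_projectiveLine {P : Fin (2 * (1 + 1) + 1) → ℤ[X]}
    (hW : IsWeilFactorization (Nat.card k) (1 + 1) (zetaSeries (projectiveSpace 1 k ⊗ projectiveSpace 1 k)) P) :
    P 2 = (1 - C (Nat.card k : ℤ) * X) ^ 2 ∧ P 1 = 1 ∧ P 3 = 1 := by
  obtain ⟨hodd, heven⟩ := hW.eq_of_projectiveSpace_tensor
  refine ⟨?_, hodd 1 ⟨0, rfl⟩, hodd 3 ⟨1, rfl⟩⟩
  rw [heven 2 1 rfl, pow_one,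
    show ((Finset.range (1 + 1) ×ˢ Finset.range (1 + 1)).filter (fun ab : ℕ × ℕ => ab.1 + ab.2 = 1)).card = 2 by
      decide]

end Weil

end Literature.AlgebraicGeometry.Motives
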